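import Mathlib
import Summits.CriticalPhenomena.PercolationContinuityZ3.Theorems.PercNearOneGluingAdditiveGluingGoodStepSingle
import Summits.CriticalPhenomena.PercolationContinuityZ3.Theorems.PercNearOneGluingAdditiveGluingGoodStepBranches
import HarnessLib

/-! # Crux `PercNearOneGluing.AdditiveGluing` (stmt-CriticalPhenomena-4576), line `subuniform-dead-pocket-maximum` — towards `stub_goodStep`, IV: the step modulo designated goodness of glued multi-stars

Helper file (siege on the HARDEST stub `stub_goodStep`, variation "explicit two-point closed form
then bootstrap"; prover-siege-stmt-CriticalPhenomena-4576-stub_goodStep-32); lands with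
`--supports stmt-CriticalPhenomena-4576`.

## Content

`goodStep_of_pinnedMultiStars`: the registered inductive step `stub_goodStep` (goodness of
`(w, A, o, b)` from goodness of every weighting with fewer positive-degree vertices — the induction
hypothesis is displayed verbatim) holds MODULO one displayed hypothesis (HT): for every set `B` of at
least two low neighbours of `o`, the good-quadruple functional of `o` under the weighting with the
star of `o` PINNED to `o–B` (= percolation on `G ∖ {o}` with the block `B` glued through the hub
`o`) is at most the DESIGNATED level `1 − μ_pin(a₀ ↔ b)`, `a₀` a minimiser over `A` of
`τ°(x) = μ(x ↔ b in {o}ᶜ)` — the worst relay of `G ∖ {o}` with `B` UNGLUED.  (For `|B| = 1` this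
designated inequality IS the induction hypothesis, transported by the companion file II; HT is the
exact residue of Kozma–Nitzan's proof of Theorem 5 when `o` has several low neighbours: gluing
`B` may re-order the relays, arXiv:2401.12397 §5.5 Questions 7–9.)  Proof = KN's proof of Theorem 5
run for an arbitrary low neighbourhood: partition by the open star of `o`, bound every branch by
`μ(σ_B ∩ {a₀ ↮ b})` (files I–III), sum to `1 − τ(a₀) ≤ t`.

`goodStep_of_atMostOneLowNeighbour`: the unconditional special case — `stub_goodStep` with the extra
hypothesis that `o` has at most one low neighbour (KN Theorem 5 for arbitrary `A ∋ b`, penalised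
selection form); HT is vacuous there.

`goodStep_card_lt`: deleting the star of a vertex with a positive-weight pair decreases the number
of positive-degree vertices (the measure of the induction).  No new definitions.
-/

namespace Summit.CriticalPhenomena.PercolationContinuityZ3.Theorems

open MeasureTheory Set
open Literature.Probability.LatticeModels (prodBernoulli)
open Literature.Probability.Percolation (BondConfig openConn openConnIn openGraph openCluster
  openGraph_adj DeterminedBy determinedBy_iff PathIn pinW localCylinder)

noncomputable section
open Classical

variable {n : ℕ}

/-! ### E. The inductive step modulo designated goodness of the pinned multi-stars -/

/-- Deleting the star of a vertex `o` that has a positive-weight non-loop pair strictly decreases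
the number of positive-degree vertices. [folklore] -/
theorem goodStep_card_lt (w : Sym2 (Fin n) → unitInterval) {o x : Fin n} (hw : (w s(o, x) : ℝ) ≠ 0) :
    (Finset.univ.filter (fun v : Fin n => ∃ u : Fin n,
        0 < ((fun e : Sym2 (Fin n) => if o ∈ e then (0 : unitInterval) else w e) s(u, v) : ℝ))).card <
      (Finset.univ.filter (fun v : Fin n => ∃ u : Fin n, 0 < (w s(u, v) : ℝ))).card := by
  apply Finset.card_lt_card
  rw [Finset.ssubset_iff_of_subset]
  · refine ⟨o, Finset.mem_filter.2 ⟨Finset.mem_univ _, x, ?_⟩, fun h => ?_⟩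
    · rw [Sym2.eq_swap]
      exact lt_of_le_of_ne (w s(o, x)).2.1 (Ne.symm hw)
    · obtain ⟨u, hu⟩ := (Finset.mem_filter.1 h).2
      simp at hu
  · intro v hv
    obtain ⟨u, hu⟩ := (Finset.mem_filter.1 hv).2
    refine Finset.mem_filter.2 ⟨Finset.mem_univ _, u, ?_⟩
    by_cases ho : o ∈ s(u, v)
    · simp [ho] at hu
    · simpa [ho] using hu

/-- **The inductive step `stub_goodStep`, modulo designated goodness of the pinned multi-stars.**
Let `b ∈ A`, `o ∉ A`, and assume (IH) the good-quadruple inequality for every weighting with fewer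
positive-degree vertices (displayed exactly as in `stub_goodStep`). Assume moreover (HT) that for
every set `B` of at least two low neighbours of `o` (`B ∩ A = ∅`, `w(o–y) ≠ 0` on `B`), the
good-quadruple functional of the observer `o` under the PINNED weighting `pinW w (star o) (o–B)`
(pairs `o–B` open, the other pairs at `o` closed, `w` elsewhere — percolation on `G ∖ {o}` with
the block `B` glued through the hub `o`) is at most the DESIGNATED level `1 − μ_pin(a₀ ↔ b)`,
`a₀` any minimiser over `A` of `τ°(x) = μ(x ↔ b in {o}ᶜ)` (the worst relay of `G ∖ {o}`, i.e. with
`B` UNGLUED). Then `GOOD(w, A, o, b)` holds (linear selection form). Proof: Kozma–Nitzan's proof of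
Theorem 5 run for an arbitrary low neighbourhood — partition by the open star `B` of `o`
(`sigmaRec_sum_preimage_inter`); `B ∋` a relay: Lemma 5 (`goodStep_branch_touch`); `B = ∅`:
`goodStep_branch_empty`; `B = {x}` dead: pinning + transport to the star-deleted graph with
observer `x` (`goodStep_single`) + IH at the level `1 − τ°(a₀)`; `|B| ≥ 2` dead: pinning + HT;
all branches are bounded by `μ(σ_B ∩ {a₀ ↮ b})`, which sums to `1 − τ(a₀) ≤ t`.
[cite: KozmaNitzan2024, §3.2 Theorem 5 (pp. 13–14)] -/
theorem goodStep_of_pinnedMultiStars :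
    ∀ (n : ℕ) (w : Sym2 (Fin n) → unitInterval) (A : Finset (Fin n)) (o b : Fin n),
      b ∈ A → o ∉ A →
      (∀ w' : Sym2 (Fin n) → unitInterval,
        (Finset.univ.filter (fun v : Fin n => ∃ u : Fin n, 0 < (w' s(u, v) : ℝ))).card
          < (Finset.univ.filter (fun v : Fin n => ∃ u : Fin n, 0 < (w s(u, v) : ℝ))).card →
        ∀ (A' : Finset (Fin n)) (o' b' : Fin n), b' ∈ A' → o' ∉ A' →
        ∀ (t : ℝ) (sel : Finset (Fin n) → Fin n), (∀ W, sel W ∈ A') →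
          (∀ a ∈ A', 1 - t ≤ (prodBernoulli w').real (openConn a b')) →
          (prodBernoulli w').real ((⋃ a ∈ A', openConn o' a) ∩ (openConn o' b')ᶜ)
            + ∑ W ∈ (Finset.univ : Finset (Finset (Fin n))).filter (fun W => o' ∈ W ∧ Disjoint W A'),
                (prodBernoulli w').real {ω : BondConfig (Fin n) | openCluster ω o' = (W : Set (Fin n))}
                  * (prodBernoulli w').real (openConnIn ((W : Set (Fin n))ᶜ) (sel W) b')ᶜ
            ≤ t) →
      (∀ B : Finset (Fin n), o ∉ B → Disjoint B A → 2 ≤ B.card →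
        (∀ y ∈ B, (w s(o, y) : ℝ) ≠ 0) →
        ∀ a₀ ∈ A, (∀ v ∈ A, (prodBernoulli w).real (openConnIn (({o} : Set (Fin n))ᶜ) a₀ b) ≤
          (prodBernoulli w).real (openConnIn (({o} : Set (Fin n))ᶜ) v b)) →
        ∀ (sel : Finset (Fin n) → Fin n), (∀ W, sel W ∈ A) →
          (prodBernoulli (pinW w ↑(Finset.univ.filter fun e : Sym2 (Fin n) => o ∈ e ∧ ¬ e.IsDiag)
              ((fun y : Fin n => s(o, y)) '' (↑B : Set (Fin n))))).real
              ((⋃ a ∈ A, openConn o a) ∩ (openConn o b)ᶜ)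
            + ∑ W ∈ (Finset.univ : Finset (Finset (Fin n))).filter (fun W => o ∈ W ∧ Disjoint W A),
                (prodBernoulli (pinW w ↑(Finset.univ.filter fun e : Sym2 (Fin n) => o ∈ e ∧ ¬ e.IsDiag)
                    ((fun y : Fin n => s(o, y)) '' (↑B : Set (Fin n))))).real
                    {ω : BondConfig (Fin n) | openCluster ω o = (W : Set (Fin n))}
                  * (prodBernoulli (pinW w ↑(Finset.univ.filter fun e : Sym2 (Fin n) => o ∈ e ∧ ¬ e.IsDiag)
                    ((fun y : Fin n => s(o, y)) '' (↑B : Set (Fin n))))).real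
                    (openConnIn ((W : Set (Fin n))ᶜ) (sel W) b)ᶜ
            ≤ 1 - (prodBernoulli (pinW w ↑(Finset.univ.filter fun e : Sym2 (Fin n) => o ∈ e ∧ ¬ e.IsDiag)
              ((fun y : Fin n => s(o, y)) '' (↑B : Set (Fin n))))).real (openConn a₀ b)) →
      ∀ (t : ℝ) (sel : Finset (Fin n) → Fin n), (∀ W, sel W ∈ A) →
        (∀ a ∈ A, 1 - t ≤ (prodBernoulli w).real (openConn a b)) →
        (prodBernoulli w).real ((⋃ a ∈ A, openConn o a) ∩ (openConn o b)ᶜ)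
          + ∑ W ∈ (Finset.univ : Finset (Finset (Fin n))).filter (fun W => o ∈ W ∧ Disjoint W A),
              (prodBernoulli w).real {ω : BondConfig (Fin n) | openCluster ω o = (W : Set (Fin n))}
                * (prodBernoulli w).real (openConnIn ((W : Set (Fin n))ᶜ) (sel W) b)ᶜ
          ≤ t := by
  intro n w A o b hbA hoA ih hT t sel hsel hrel
  have hbo : b ≠ o := fun h => hoA (h ▸ hbA)
  -- the minimiser `a₀` of `τ°` over `A`
  obtain ⟨a₀, ha₀A, hmin⟩ := Finset.exists_min_image A
    (fun x => (prodBernoulli w).real (openConnIn (({o} : Set (Fin n))ᶜ) x b)) ⟨b, hbA⟩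
  have ha₀o : a₀ ≠ o := fun h => hoA (h ▸ ha₀A)
  -- the star of `o` and the patterns on it
  obtain ⟨F, hFdef⟩ : ∃ F : Finset (Sym2 (Fin n)),
      F = Finset.univ.filter fun e : Sym2 (Fin n) => o ∈ e ∧ ¬ e.IsDiag := ⟨_, rfl⟩
  have hF : ∀ e, e ∈ F ↔ o ∈ e ∧ ¬ e.IsDiag := fun e => by rw [hFdef]; simp
  have hξ : ∀ (B : Finset (Fin n)) (y : Fin n),
      s(o, y) ∈ ((fun y : Fin n => s(o, y)) '' (↑B : Set (Fin n))) ↔ y ∈ B := fun B y => by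
    rw [Function.Injective.mem_set_image fun y y' h => Sym2.congr_right.1 h, Finset.mem_coe]
  rw [← hFdef] at hT
  -- it suffices to bound by `1 - τ(a₀)`
  suffices key : (prodBernoulli w).real ((⋃ a ∈ A, openConn o a) ∩ (openConn o b)ᶜ)
      + ∑ W ∈ (Finset.univ : Finset (Finset (Fin n))).filter (fun W => o ∈ W ∧ Disjoint W A),
          (prodBernoulli w).real {ω : BondConfig (Fin n) | openCluster ω o = (W : Set (Fin n))}
            * (prodBernoulli w).real (openConnIn ((W : Set (Fin n))ᶜ) (sel W) b)ᶜ
      ≤ (prodBernoulli w).real (openConn a₀ b)ᶜ by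
    rw [probReal_compl_eq_one_sub MeasurableSet.of_discrete] at key
    linarith [hrel a₀ ha₀A]
  -- partition everything by the open star of `o`
  have hpart : ∀ X : Set (BondConfig (Fin n)), (prodBernoulli w).real X =
      ∑ B : Finset (Fin n), (prodBernoulli w).real
        ((fun ω : BondConfig (Fin n) => Finset.univ.filter fun y : Fin n => y ≠ o ∧ s(o, y) ∈ ω) ⁻¹' {B}
          ∩ X) := fun X => (sigmaRec_sum_preimage_inter w _ X).symm
  have hpen : ∑ W ∈ (Finset.univ : Finset (Finset (Fin n))).filter (fun W => o ∈ W ∧ Disjoint W A),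
      (prodBernoulli w).real {ω : BondConfig (Fin n) | openCluster ω o = (W : Set (Fin n))}
        * (prodBernoulli w).real (openConnIn ((W : Set (Fin n))ᶜ) (sel W) b)ᶜ =
      ∑ B : Finset (Fin n),
        ∑ W ∈ (Finset.univ : Finset (Finset (Fin n))).filter (fun W => o ∈ W ∧ Disjoint W A),
          (prodBernoulli w).real
            ((fun ω : BondConfig (Fin n) => Finset.univ.filter fun y : Fin n => y ≠ o ∧ s(o, y) ∈ ω) ⁻¹' {B}
              ∩ {ω : BondConfig (Fin n) | openCluster ω o = (W : Set (Fin n))})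
            * (prodBernoulli w).real (openConnIn ((W : Set (Fin n))ᶜ) (sel W) b)ᶜ := by
    rw [Finset.sum_comm]
    refine Finset.sum_congr rfl fun W _ => ?_
    rw [hpart {ω : BondConfig (Fin n) | openCluster ω o = (W : Set (Fin n))}, Finset.sum_mul]
  rw [hpart ((⋃ a ∈ A, openConn o a) ∩ (openConn o b)ᶜ), hpart (openConn a₀ b)ᶜ, hpen,
    ← Finset.sum_add_distrib]
  refine Finset.sum_le_sum fun B _ => ?_
  -- the branch `B`
  by_cases hoB : o ∈ B
  · simp [goodBase_fibre_eq_empty o B hoB]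
  rw [goodBase_fibre_eq o B hoB]
  by_cases hB0 : B = ∅
  · subst hB0
    have h0 : {ω : BondConfig (Fin n) | ∀ y : Fin n, y ≠ o → (s(o, y) ∈ ω ↔ y ∈ (∅ : Finset (Fin n)))} =
        {ω : BondConfig (Fin n) | ∀ y : Fin n, y ≠ o → s(o, y) ∉ ω} := by
      ext ω; simp
    rw [h0]
    exact goodStep_branch_empty w A hoA ha₀o sel (hmin (sel {o}) (hsel {o}))
  by_cases hnull : (prodBernoulli w).real
      {ω : BondConfig (Fin n) | ∀ y : Fin n, y ≠ o → (s(o, y) ∈ ω ↔ y ∈ B)} = 0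
  · exact goodStep_branch_null w _ _ _ _ _ _ hnull
  have hpos : ∀ y ∈ B, (w s(o, y) : ℝ) ≠ 0 := by
    intro y hyB hy0
    have hyo : y ≠ o := fun h => hoB (h ▸ hyB)
    refine hnull (sigmaRec_null w _ {s(o, y)} (fun e he => ?_) fun ω hω => ?_)
    · rw [Finset.mem_singleton.1 he]
      exact Set.Icc.coe_eq_zero.1 hy0
    · exact ⟨s(o, y), Finset.mem_singleton_self _, (hω y hyo).2 hyB⟩
  by_cases htouch : (B ∩ A).Nonempty
  · obtain ⟨v, hv⟩ := htouch
    rw [Finset.mem_inter] at hv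
    exact goodStep_branch_touch w A B hbo ha₀o hoB hv.1 hv.2 sel (hmin v hv.2)
  have hdisj : Disjoint B A := Finset.disjoint_iff_inter_eq_empty.2 (Finset.not_nonempty_iff_eq_empty.1 htouch)
  -- dead branch: pin the star
  refine goodStep_branch_of_pinned w A B sel hF (hξ B) ?_
  by_cases hcard : 2 ≤ B.card
  · exact hT B hoB hdisj hcard hpos a₀ ha₀A hmin sel hsel
  -- `B = {x}`: transport to the star-deleted graph and use the induction hypothesis
  obtain ⟨x, rfl⟩ : ∃ x, B = {x} := Finset.card_eq_one.1
    (by have := Finset.card_pos.2 (Finset.nonempty_of_ne_empty hB0); omega)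
  have hxo : x ≠ o := fun h => hoB (h ▸ Finset.mem_singleton_self x)
  have hxA : x ∉ A := Finset.disjoint_singleton_left.1 hdisj
  have hwx : (w s(o, x) : ℝ) ≠ 0 := hpos x (Finset.mem_singleton_self x)
  refine goodStep_single w A hxo hbo hoA ha₀o sel hsel hF (hξ {x}) ?_
  have hτ : ∀ a : Fin n, a ≠ o → (prodBernoulli w).real (openConnIn (({o} : Set (Fin n))ᶜ) a b) =
      (prodBernoulli (fun e : Sym2 (Fin n) => if o ∈ e then (0 : unitInterval) else w e)).real
        (openConn a b) := fun a ha =>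
    lemma5AnyRelay_real_openConnIn_compl_eq w _ o a b ha (goodStep_del_offstar w o)
      fun y _ => by simp
  refine ih _ (goodStep_card_lt w hwx) A x b hbA hxA _ (fun W' => sel (insert o W')) (fun W' => hsel _)
    fun a ha => ?_
  rw [sub_sub_cancel, ← hτ a₀ ha₀o, ← hτ a (ne_of_mem_of_not_mem ha hoA)]
  exact hmin a ha


/-- **`stub_goodStep` when the observer has at most one low neighbour** — Kozma–Nitzan's
Theorem 5 (arXiv:2401.12397, p. 13: "`0` is isolated in `G ∖ (A ∪ {x})`") in the penalised linear
selection form of the line, for an arbitrary relay set `A ∋ b`, the goodness of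
`(G ∖ {0}, A, x, b)` being supplied by the induction hypothesis of `stub_goodStep` (displayed
verbatim). The hypotheses are those of `stub_goodStep` plus uniqueness of the low neighbour; the
multi-star hypothesis of `goodStep_of_pinnedMultiStars` is then vacuous.
[cite: KozmaNitzan2024, §3.2 Theorem 5 (pp. 13–14)] -/
theorem goodStep_of_atMostOneLowNeighbour :
    ∀ (n : ℕ) (w : Sym2 (Fin n) → unitInterval) (A : Finset (Fin n)) (o b : Fin n),
      b ∈ A → o ∉ A →
      (∀ y y' : Fin n, y ∉ A → y ≠ o → (w s(o, y) : ℝ) ≠ 0 →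
        y' ∉ A → y' ≠ o → (w s(o, y') : ℝ) ≠ 0 → y = y') →
      (∀ w' : Sym2 (Fin n) → unitInterval,
        (Finset.univ.filter (fun v : Fin n => ∃ u : Fin n, 0 < (w' s(u, v) : ℝ))).card
          < (Finset.univ.filter (fun v : Fin n => ∃ u : Fin n, 0 < (w s(u, v) : ℝ))).card →
        ∀ (A' : Finset (Fin n)) (o' b' : Fin n), b' ∈ A' → o' ∉ A' →
        ∀ (t : ℝ) (sel : Finset (Fin n) → Fin n), (∀ W, sel W ∈ A') →
          (∀ a ∈ A', 1 - t ≤ (prodBernoulli w').real (openConn a b')) →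
          (prodBernoulli w').real ((⋃ a ∈ A', openConn o' a) ∩ (openConn o' b')ᶜ)
            + ∑ W ∈ (Finset.univ : Finset (Finset (Fin n))).filter (fun W => o' ∈ W ∧ Disjoint W A'),
                (prodBernoulli w').real {ω : BondConfig (Fin n) | openCluster ω o' = (W : Set (Fin n))}
                  * (prodBernoulli w').real (openConnIn ((W : Set (Fin n))ᶜ) (sel W) b')ᶜ
            ≤ t) →
      ∀ (t : ℝ) (sel : Finset (Fin n) → Fin n), (∀ W, sel W ∈ A) →
        (∀ a ∈ A, 1 - t ≤ (prodBernoulli w).real (openConn a b)) →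
        (prodBernoulli w).real ((⋃ a ∈ A, openConn o a) ∩ (openConn o b)ᶜ)
          + ∑ W ∈ (Finset.univ : Finset (Finset (Fin n))).filter (fun W => o ∈ W ∧ Disjoint W A),
              (prodBernoulli w).real {ω : BondConfig (Fin n) | openCluster ω o = (W : Set (Fin n))}
                * (prodBernoulli w).real (openConnIn ((W : Set (Fin n))ᶜ) (sel W) b)ᶜ
          ≤ t := by
  intro n w A o b hbA hoA huniq ih
  refine goodStep_of_pinnedMultiStars n w A o b hbA hoA ih fun B hoB hdisj hcard hpos => ?_
  exfalso
  obtain ⟨y, hy, y', hy', hne⟩ := Finset.one_lt_card.1 hcard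
  exact hne (huniq y y' (Finset.disjoint_left.1 hdisj hy) (fun h => hoB (h ▸ hy)) (hpos y hy)
    (Finset.disjoint_left.1 hdisj hy') (fun h => hoB (h ▸ hy')) (hpos y' hy'))

/-! ### Registered waypoints (siege k32) -/

/-- Registered sub-goal `stub_goodStepMultiStar_k32` of stmt-CriticalPhenomena-4576 (siege k32 on
`stub_goodStep`): `stub_goodStep` modulo the designated goodness (HT) of the pinned multi-stars
(= `goodStep_of_pinnedMultiStars`). [cite: KozmaNitzan2024, §3.2 Theorem 5 (pp. 13–14)] -/
theorem stub_goodStepMultiStar_k32 :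
    ∀ (n : ℕ) (w : Sym2 (Fin n) → unitInterval) (A : Finset (Fin n)) (o b : Fin n),
      b ∈ A → o ∉ A →
      (∀ w' : Sym2 (Fin n) → unitInterval,
        (Finset.univ.filter (fun v : Fin n => ∃ u : Fin n, 0 < (w' s(u, v) : ℝ))).card
          < (Finset.univ.filter (fun v : Fin n => ∃ u : Fin n, 0 < (w s(u, v) : ℝ))).card →
        ∀ (A' : Finset (Fin n)) (o' b' : Fin n), b' ∈ A' → o' ∉ A' →
        ∀ (t : ℝ) (sel : Finset (Fin n) → Fin n), (∀ W, sel W ∈ A') →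
          (∀ a ∈ A', 1 - t ≤ (prodBernoulli w').real (openConn a b')) →
          (prodBernoulli w').real ((⋃ a ∈ A', openConn o' a) ∩ (openConn o' b')ᶜ)
            + ∑ W ∈ (Finset.univ : Finset (Finset (Fin n))).filter (fun W => o' ∈ W ∧ Disjoint W A'),
                (prodBernoulli w').real {ω : BondConfig (Fin n) | openCluster ω o' = (W : Set (Fin n))}
                  * (prodBernoulli w').real (openConnIn ((W : Set (Fin n))ᶜ) (sel W) b')ᶜ
            ≤ t) →
      (∀ B : Finset (Fin n), o ∉ B → Disjoint B A → 2 ≤ B.card →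
        (∀ y ∈ B, (w s(o, y) : ℝ) ≠ 0) →
        ∀ a₀ ∈ A, (∀ v ∈ A, (prodBernoulli w).real (openConnIn (({o} : Set (Fin n))ᶜ) a₀ b) ≤
          (prodBernoulli w).real (openConnIn (({o} : Set (Fin n))ᶜ) v b)) →
        ∀ (sel : Finset (Fin n) → Fin n), (∀ W, sel W ∈ A) →
          (prodBernoulli (pinW w ↑(Finset.univ.filter fun e : Sym2 (Fin n) => o ∈ e ∧ ¬ e.IsDiag)
              ((fun y : Fin n => s(o, y)) '' (↑B : Set (Fin n))))).real
              ((⋃ a ∈ A, openConn o a) ∩ (openConn o b)ᶜ)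
            + ∑ W ∈ (Finset.univ : Finset (Finset (Fin n))).filter (fun W => o ∈ W ∧ Disjoint W A),
                (prodBernoulli (pinW w ↑(Finset.univ.filter fun e : Sym2 (Fin n) => o ∈ e ∧ ¬ e.IsDiag)
                    ((fun y : Fin n => s(o, y)) '' (↑B : Set (Fin n))))).real
                    {ω : BondConfig (Fin n) | openCluster ω o = (W : Set (Fin n))}
                  * (prodBernoulli (pinW w ↑(Finset.univ.filter fun e : Sym2 (Fin n) => o ∈ e ∧ ¬ e.IsDiag)
                    ((fun y : Fin n => s(o, y)) '' (↑B : Set (Fin n))))).real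
                    (openConnIn ((W : Set (Fin n))ᶜ) (sel W) b)ᶜ
            ≤ 1 - (prodBernoulli (pinW w ↑(Finset.univ.filter fun e : Sym2 (Fin n) => o ∈ e ∧ ¬ e.IsDiag)
              ((fun y : Fin n => s(o, y)) '' (↑B : Set (Fin n))))).real (openConn a₀ b)) →
      ∀ (t : ℝ) (sel : Finset (Fin n) → Fin n), (∀ W, sel W ∈ A) →
        (∀ a ∈ A, 1 - t ≤ (prodBernoulli w).real (openConn a b)) →
        (prodBernoulli w).real ((⋃ a ∈ A, openConn o a) ∩ (openConn o b)ᶜ)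
          + ∑ W ∈ (Finset.univ : Finset (Finset (Fin n))).filter (fun W => o ∈ W ∧ Disjoint W A),
              (prodBernoulli w).real {ω : BondConfig (Fin n) | openCluster ω o = (W : Set (Fin n))}
                * (prodBernoulli w).real (openConnIn ((W : Set (Fin n))ᶜ) (sel W) b)ᶜ
          ≤ t  :=
  goodStep_of_pinnedMultiStars

/-- Registered sub-goal `stub_goodStepOneLow_k32` of stmt-CriticalPhenomena-4576 (siege k32 on
`stub_goodStep`): `stub_goodStep` when the observer has at most one low neighbour — Kozma–Nitzan's
Theorem 5 for an arbitrary relay set, penalised selection form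
(= `goodStep_of_atMostOneLowNeighbour`). [cite: KozmaNitzan2024, §3.2 Theorem 5 (pp. 13–14)] -/
theorem stub_goodStepOneLow_k32 :
    ∀ (n : ℕ) (w : Sym2 (Fin n) → unitInterval) (A : Finset (Fin n)) (o b : Fin n),
      b ∈ A → o ∉ A →
      (∀ y y' : Fin n, y ∉ A → y ≠ o → (w s(o, y) : ℝ) ≠ 0 →
        y' ∉ A → y' ≠ o → (w s(o, y') : ℝ) ≠ 0 → y = y') →
      (∀ w' : Sym2 (Fin n) → unitInterval,
        (Finset.univ.filter (fun v : Fin n => ∃ u : Fin n, 0 < (w' s(u, v) : ℝ))).card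
          < (Finset.univ.filter (fun v : Fin n => ∃ u : Fin n, 0 < (w s(u, v) : ℝ))).card →
        ∀ (A' : Finset (Fin n)) (o' b' : Fin n), b' ∈ A' → o' ∉ A' →
        ∀ (t : ℝ) (sel : Finset (Fin n) → Fin n), (∀ W, sel W ∈ A') →
          (∀ a ∈ A', 1 - t ≤ (prodBernoulli w').real (openConn a b')) →
          (prodBernoulli w').real ((⋃ a ∈ A', openConn o' a) ∩ (openConn o' b')ᶜ)
            + ∑ W ∈ (Finset.univ : Finset (Finset (Fin n))).filter (fun W => o' ∈ W ∧ Disjoint W A'),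
                (prodBernoulli w').real {ω : BondConfig (Fin n) | openCluster ω o' = (W : Set (Fin n))}
                  * (prodBernoulli w').real (openConnIn ((W : Set (Fin n))ᶜ) (sel W) b')ᶜ
            ≤ t) →
      ∀ (t : ℝ) (sel : Finset (Fin n) → Fin n), (∀ W, sel W ∈ A) →
        (∀ a ∈ A, 1 - t ≤ (prodBernoulli w).real (openConn a b)) →
        (prodBernoulli w).real ((⋃ a ∈ A, openConn o a) ∩ (openConn o b)ᶜ)
          + ∑ W ∈ (Finset.univ : Finset (Finset (Fin n))).filter (fun W => o ∈ W ∧ Disjoint W A),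
              (prodBernoulli w).real {ω : BondConfig (Fin n) | openCluster ω o = (W : Set (Fin n))}
                * (prodBernoulli w).real (openConnIn ((W : Set (Fin n))ᶜ) (sel W) b)ᶜ
          ≤ t  :=
  goodStep_of_atMostOneLowNeighbour

end

end Summit.CriticalPhenomena.PercolationContinuityZ3.Theorems
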